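import Literature.AlgebraicGeometry.GroupSchemes.EtaleGroupSchemeConstant
import Literature.AlgebraicGeometry.GroupSchemes.AffineGroupSchemeSpecPoints
import Literature.AlgebraicGeometry.Motives.AbelianVarietyEtaleIsogenyFrobeniusKernel
import Literature.AlgebraicGeometry.Motives.AbelianVarietyIsogenyEtale
import Literature.AlgebraicGeometry.AbelianSchemes.AbelianSchemeOverField
import HarnessLib

/-!
# Kernels with finite étale kernel scheme are DECIDED ON POINTS over an algebraically closed field;
# isogenies of abelian varieties in characteristic zero

Topic `Literature/AlgebraicGeometry/GroupSchemes` (§1–§2, namespace `Literature.AlgebraicGeometry.GroupSchemes.GroupSchemeKernel`) and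
`Literature/AlgebraicGeometry/AbelianSchemes` (§3–§4, namespace `Literature.AlgebraicGeometry.AbelianSchemes.AbelianSchemeOver`).
THEOREMS ONLY (no definition, no named fact, no `instance`, no notation, no `sorry`).  Cell `hodgecm-mathlib` (D-0151), FLOOR 0, P6
«MOD programme» (crux hLiu418 = stmt-HodgeConjecture-24832, `--supports`, count-neutral), σ2 (β′) lineage of `stub_HFROB`, organ **G1a
«KERNELS ARE DECIDED ON Ω-POINTS»** (KIT memo v2 §3): the isogeny roof `A_y —q→ B ←c— A_y″` of the moduli datum (`RoofΩ`, (r1)(r2)) records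
the kernels of `q` and `c` on `Ω`-POINTS only (`Ω = Ω̄` of characteristic `0`), whereas the descent engines ★
`AbelianSchemeHomDescentKernelEq.exists_iso_comp_eq_of_comp_eq_one_iff` («equal kernels ⇒ isomorphic under `A`») and ★
`FrobeniusVersusHeckeSerreTensor` (`hker`) want the kernels as SUBGROUP FUNCTORS: `∀ T, ∀ t : T ⟶ A, t ≫ ψ = 1 ↔ t ≫ φ = 1`.
This file closes the gap.  HC_CM is proved only modulo the 2 remaining named inputs (hLiu418, h413) until rung 0 closes; this file
discharges none of them.

THE ARGUMENT.  Let `k = k̄`, `f : G → H` a homomorphism of `k`-group schemes whose kernel `Ker f → Spec k` is FINITE ÉTALE, and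
`g, g′ : G → Y` two morphisms agreeing on every `k`-point of `G` killed by `f`.  Then `g` and `g′` agree on `Ker f`
(`kerι f ≫ g = kerι f ≫ g′`): a finite étale scheme over an algebraically closed field is the constant scheme on its sections, so
morphisms out of it are determined by their values on sections (★ `EtaleGroupSchemeConstant.hom_ext_of_sections`,
[Tate1997FiniteFlatGroupSchemes] (3.7), [StacksProject] Tag 00U3), and a section of `Ker f` IS a `k`-point of `G` killed by `f`.
Consequently every `T`-valued point `t` of `G` with `t ≫ f = 1` — which factors through `Ker f` ([GortzWedhorn2020] Def. 4.45 (2)) — has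
`t ≫ g = t ≫ g′` (§2); with `g′ = 1` and `g` a homomorphism: `Ker f ⊆ Ker g` as subgroup functors as soon as it holds on `k`-points, and
`Ker f = Ker g` as subgroup functors as soon as both kernels are finite étale and agree on `k`-points.  For abelian varieties over
`Ω = Ω̄` with `char Ω = 0` every isogeny is étale (Cartier: [GortzWedhorn2023] Thm. 27.25 ∕ Cor. 27.63; [MumfordAV1970] §7 Thm. 4; ★
`Motives.AbelianVariety.IsIsogeny.etale`), so its kernel — the base change of the isogeny along the unit section — is finite étale, and
§1–§2 apply (§3); §4 is the family form (`Ker c = ⋂ᵢ Ker φᵢ`, e.g. the `𝔞`-torsion `A[𝔞] = ⋂_{a ∈ 𝔞} Ker ι(a)` of (r2)) through an auxiliary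
isogeny with that scheme-theoretic kernel (e.g. the Serre translate `A → A ⊗ 𝔞⁻¹`).

## Contents
* §0 `etale_ker_hom_of_etale_left` — `Ker F → S` is étale when `F` is (base change along the unit section; sibling of ★
  `isFinite_ker_hom_of_isFinite_left`, ★ `flat_ker_hom_of_flat_left`).
* §1 (`k = k̄`, `Ker f` finite étale) **`kerι_comp_eq_kerι_comp_of_forall_section`**, **`kerι_comp_eq_one_of_forall_section`**.
* §2 **`comp_eq_of_comp_eq_one_of_forall_section`**, **`comp_eq_one_of_comp_eq_one_of_forall_section`** (`Ker f ⊆ Ker g` on all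
  `T`-points from `k`-points), **`comp_eq_one_iff_of_forall_section`** (`Ker f = Ker g`); the same with `k`-points read as
  `specOver k k ⟶ G` (the tree's `Motives.AlgPoints` test object; ★ `AffineGroupScheme.unitIsoSpecOver`):
  `comp_eq_one_of_comp_eq_one_of_forall_algPoint`, `comp_eq_one_iff_of_forall_algPoint`.
* §3 (`Ω = Ω̄`, `CharZero Ω`, `A B C : AbelianSchemeOver (Spec Ω)`, `ψ : A → C` a homomorphism with `ψ.left` finite surjective)
  `etale_left_of_isFinite_of_surjective`, `etale_ker_hom_of_isFinite_of_surjective`, `isFinite_ker_hom_of_isFinite`,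
  **`comp_eq_one_of_forall_points_of_charZero`** (hypothesis `∀ P : A(Ω), ψ(P) = 1 → φ(P) = 1` in `AlgPoints.map` currency — the shape
  of `RoofΩ` (r1)(r2)), **`comp_eq_one_iff_of_forall_points_of_charZero`** (both isogenies; conclusion = the `hker` of ★ KER-EQ verbatim),
  and the FIBRE forms `…_fibre` for `A = 𝒜.baseChange t`, points of `(𝒜.fibre t).toAbelianVariety` (the `schΩOf`∕`fibreΩOf` pair of the datum).
* §4 **`comp_eq_one_iff_forall_of_forall_points_of_charZero`** — family form: `t ≫ c = 1 ↔ ∀ i, p i → t ≫ φ i = 1` from the same law on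
  `Ω`-points and ONE auxiliary isogeny `ψ′` with that scheme kernel.

## References
* [Tate1997FiniteFlatGroupSchemes] J. Tate, *Finite flat group schemes*, in Cornell–Silverman–Stevens (eds.), *Modular Forms and Fermat's Last
  Theorem* (1997), (3.7) (p. 137).
* [StacksProject] The Stacks Project, Tag 00U3.
* [GortzWedhorn2020] U. Görtz, T. Wedhorn, *Algebraic Geometry I* (2nd ed. 2020), Definition 4.45 (2) (p. 117).
* [GortzWedhorn2023] U. Görtz, T. Wedhorn, *Algebraic Geometry II* (2023), Thm. 27.25, Cor. 27.63.
* [MumfordAV1970] D. Mumford, *Abelian Varieties* (1970), §7 Thm. 4 (p. 72).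
-/

noncomputable section

universe u

open CategoryTheory CategoryTheory.Limits AlgebraicGeometry MonoidalCategory CartesianMonoidalCategory
open scoped MonObj

/-! ## §0–§2 Group schemes over an algebraically closed field -/

namespace Literature.AlgebraicGeometry.GroupSchemes.GroupSchemeKernel

open Literature.AlgebraicGeometry.Motives (SchemeOver specOver)

/-! ### §0 The kernel of an étale homomorphism is étale over the base -/

section AnyBase

variable {S : Scheme.{u}} {G G' : Over S} [GrpObj G']

/-- `Ker F → S` is ÉTALE when `F` is (it is the base change of `F` along the unit section `e : S → G′`).
[cite: GortzWedhorn2020, Definition 4.45 (2) (p. 117)] -/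
theorem etale_ker_hom_of_etale_left (F : G ⟶ G') [Etale F.left] : Etale (ker F).hom := by
  rw [← snd_left_eq_ker_hom F]
  exact MorphismProperty.of_isPullback (P := @Etale) (isPullback_kerι_left F) ‹_›

end AnyBase

section Field

variable {k : Type u} [Field k] [IsAlgClosed k] {G H : Over (Spec (.of k))} [GrpObj G] [GrpObj H]
  (f : G ⟶ H) [IsMonHom f] [IsFinite (ker f).hom] [Etale (ker f).hom]

/-! ### §1 Morphisms agreeing on the `k`-points killed by `f` agree on `Ker f` -/

/-- **Two morphisms `g, g′ : G → Y` agreeing on every `k`-point of `G` killed by `f` agree on `Ker f`** (`k = k̄`, `Ker f → Spec k`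
finite étale): `kerι f ≫ g = kerι f ≫ g′` — morphisms out of the finite étale `Ker f` are determined on sections, and a section of
`Ker f` is a `k`-point of `G` killed by `f`. [cite: Tate1997FiniteFlatGroupSchemes, (3.7)] [cite: StacksProject, Tag 00U3]
[cite: GortzWedhorn2020, Definition 4.45 (2) (p. 117)] -/
theorem kerι_comp_eq_kerι_comp_of_forall_section {Y : Over (Spec (.of k))} (g g' : G ⟶ Y)
    (h : ∀ s : 𝟙_ (Over (Spec (.of k))) ⟶ G, s ≫ f = 1 → s ≫ g = s ≫ g') :
    kerι f ≫ g = kerι f ≫ g' := by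
  refine EtaleGroupSchemeConstant.hom_ext_of_sections (ker f) (kerι f ≫ g) (kerι f ≫ g') fun s => ?_
  rw [← Category.assoc, ← Category.assoc]
  exact h (s ≫ kerι f) (by rw [Category.assoc, kerι_comp, MonObj.comp_one])

/-- **`Ker f ⊆ Ker g` ON `k`-POINTS ⇒ `Ker f → G → H′` IS TRIVIAL** (`k = k̄`, `Ker f` finite étale, `g : G → H′` a morphism to a group
scheme): `kerι f ≫ g = 1`. [cite: Tate1997FiniteFlatGroupSchemes, (3.7)] [cite: GortzWedhorn2020, Definition 4.45 (2) (p. 117)] -/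
theorem kerι_comp_eq_one_of_forall_section {H' : Over (Spec (.of k))} [GrpObj H'] (g : G ⟶ H')
    (h : ∀ s : 𝟙_ (Over (Spec (.of k))) ⟶ G, s ≫ f = 1 → s ≫ g = 1) : kerι f ≫ g = 1 := by
  rw [← MonObj.comp_one (kerι f)]
  exact kerι_comp_eq_kerι_comp_of_forall_section f g 1 fun s hs => by rw [h s hs, MonObj.comp_one]

/-! ### §2 … hence on all `T`-valued points -/

/-- **Morphisms agreeing on the `k`-points killed by `f` agree on every `T`-valued point killed by `f`** (it factors through `Ker f`,
★ `kerLift`). [cite: GortzWedhorn2020, Definition 4.45 (2) (p. 117)] [cite: Tate1997FiniteFlatGroupSchemes, (3.7)] -/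
theorem comp_eq_of_comp_eq_one_of_forall_section {Y : Over (Spec (.of k))} (g g' : G ⟶ Y)
    (h : ∀ s : 𝟙_ (Over (Spec (.of k))) ⟶ G, s ≫ f = 1 → s ≫ g = s ≫ g')
    {T : Over (Spec (.of k))} (t : T ⟶ G) (ht : t ≫ f = 1) : t ≫ g = t ≫ g' := by
  rw [← kerLift_ι t ht, Category.assoc, Category.assoc, kerι_comp_eq_kerι_comp_of_forall_section f g g' h]

/-- **`Ker f ⊆ Ker g` ON `k`-POINTS ⇒ `Ker f ⊆ Ker g` ON ALL `T`-VALUED POINTS** (`k = k̄`, `Ker f` finite étale): `t ≫ f = 1 → t ≫ g = 1`.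
[cite: Tate1997FiniteFlatGroupSchemes, (3.7)] [cite: GortzWedhorn2020, Definition 4.45 (2) (p. 117)] -/
theorem comp_eq_one_of_comp_eq_one_of_forall_section {H' : Over (Spec (.of k))} [GrpObj H'] (g : G ⟶ H')
    (h : ∀ s : 𝟙_ (Over (Spec (.of k))) ⟶ G, s ≫ f = 1 → s ≫ g = 1)
    {T : Over (Spec (.of k))} (t : T ⟶ G) (ht : t ≫ f = 1) : t ≫ g = 1 := by
  rw [← kerLift_ι t ht, Category.assoc, kerι_comp_eq_one_of_forall_section f g h, MonObj.comp_one]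

/-- **`Ker f = Ker g` ON `k`-POINTS ⇒ `Ker f = Ker g` AS SUBGROUP FUNCTORS** when BOTH kernels are finite étale (`k = k̄`):
`t ≫ f = 1 ↔ t ≫ g = 1` for every `T`-valued point `t` — the `hker` hypothesis of ★ `AbelianSchemeHomDescentKernelEq`.
[cite: Tate1997FiniteFlatGroupSchemes, (3.7)] [cite: GortzWedhorn2020, Definition 4.45 (2) (p. 117)] -/
theorem comp_eq_one_iff_of_forall_section {H' : Over (Spec (.of k))} [GrpObj H'] (g : G ⟶ H') [IsMonHom g]
    [IsFinite (ker g).hom] [Etale (ker g).hom]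
    (h : ∀ s : 𝟙_ (Over (Spec (.of k))) ⟶ G, s ≫ f = 1 ↔ s ≫ g = 1)
    {T : Over (Spec (.of k))} (t : T ⟶ G) : t ≫ f = 1 ↔ t ≫ g = 1 :=
  ⟨comp_eq_one_of_comp_eq_one_of_forall_section f g (fun s hs => (h s).1 hs) t,
    comp_eq_one_of_comp_eq_one_of_forall_section g f (fun s hs => (h s).2 hs) t⟩

/-! The same with `k`-points read on the test object `specOver k k` of the tree's `Motives.AlgPoints` (★ `AffineGroupScheme.unitIsoSpecOver :
𝟙_ ≅ specOver k k`). -/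

/-- `Ker f ⊆ Ker g` on `k`-points in `AlgPoints` currency (`P : specOver k k ⟶ G`) ⇒ on all `T`-valued points.
[cite: Tate1997FiniteFlatGroupSchemes, (3.7)] [cite: GortzWedhorn2020, Definition 4.45 (2) (p. 117)] -/
theorem comp_eq_one_of_comp_eq_one_of_forall_algPoint {H' : Over (Spec (.of k))} [GrpObj H'] (g : G ⟶ H')
    (h : ∀ P : specOver k k ⟶ G, P ≫ f = 1 → P ≫ g = 1)
    {T : Over (Spec (.of k))} (t : T ⟶ G) (ht : t ≫ f = 1) : t ≫ g = 1 := by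
  refine comp_eq_one_of_comp_eq_one_of_forall_section f g (fun s hs => ?_) t ht
  have h1 := h (AffineGroupScheme.unitIsoSpecOver.inv ≫ s) (by rw [Category.assoc, hs, MonObj.comp_one])
  rw [Category.assoc] at h1
  rw [← Category.id_comp (s ≫ g), ← AffineGroupScheme.unitIsoSpecOver.hom_inv_id, Category.assoc, h1, MonObj.comp_one]

/-- `Ker f = Ker g` on `k`-points in `AlgPoints` currency ⇒ as subgroup functors (both kernels finite étale).
[cite: Tate1997FiniteFlatGroupSchemes, (3.7)] [cite: GortzWedhorn2020, Definition 4.45 (2) (p. 117)] -/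
theorem comp_eq_one_iff_of_forall_algPoint {H' : Over (Spec (.of k))} [GrpObj H'] (g : G ⟶ H') [IsMonHom g]
    [IsFinite (ker g).hom] [Etale (ker g).hom]
    (h : ∀ P : specOver k k ⟶ G, P ≫ f = 1 ↔ P ≫ g = 1)
    {T : Over (Spec (.of k))} (t : T ⟶ G) : t ≫ f = 1 ↔ t ≫ g = 1 :=
  ⟨comp_eq_one_of_comp_eq_one_of_forall_algPoint f g (fun P hP => (h P).1 hP) t,
    comp_eq_one_of_comp_eq_one_of_forall_algPoint g f (fun P hP => (h P).2 hP) t⟩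

end Field

end Literature.AlgebraicGeometry.GroupSchemes.GroupSchemeKernel

/-! ## §3–§4 Abelian varieties over an algebraically closed field of characteristic zero -/

namespace Literature.AlgebraicGeometry.AbelianSchemes

namespace AbelianSchemeOver

open Literature.AlgebraicGeometry.Motives (AlgPoints SchemeOver specOver)
open Literature.AlgebraicGeometry.Motives.AbelianVariety (IsIsogeny)
open Literature.AlgebraicGeometry.GroupSchemes.GroupSchemeKernel

variable {Ω : Type u} [Field Ω] {A B C : AbelianSchemeOver (Spec (.of Ω))}
  (ψ : A.X ⟶ C.X) [IsMonHom ψ] (φ : A.X ⟶ B.X)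

/-! ### §3 Isogenies: étale in characteristic zero, kernels decided on `Ω`-points -/

/-- **An isogeny of abelian varieties over a field of CHARACTERISTIC ZERO is ÉTALE** (Cartier; in the `AbelianSchemeOver (Spec Ω)` ∕ `Over`
currency: a homomorphism `ψ : A → C` with `ψ.left` finite and surjective; ★ `IsIsogeny.etale` read through the identity of carriers ★
`toAffine`, ★ `toAbelianVariety`). [cite: GortzWedhorn2023, Thm. 27.25 and Cor. 27.63] [cite: MumfordAV1970, §7 Thm. 4 (p. 72)] -/
theorem etale_left_of_isFinite_of_surjective [CharZero Ω] [IsFinite ψ.left] [Surjective ψ.left] : Etale ψ.left :=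
  IsIsogeny.etale
    (f := InducedCategory.homMk (X := A.toAffine.toAbelianVariety) (Y := C.toAffine.toAbelianVariety) (Grp.ofHom ψ :))
    ⟨‹_›, ‹_›⟩

/-- … so its KERNEL `Ker ψ → Spec Ω` is ÉTALE … [cite: GortzWedhorn2023, Thm. 27.25 and Cor. 27.63] [cite: GortzWedhorn2020, Definition 4.45 (2) (p. 117)] -/
theorem etale_ker_hom_of_isFinite_of_surjective [CharZero Ω] [IsFinite ψ.left] [Surjective ψ.left] : Etale (ker ψ).hom :=
  haveI := etale_left_of_isFinite_of_surjective ψ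
  etale_ker_hom_of_etale_left ψ

omit [IsMonHom ψ] in
/-- … and FINITE. [cite: GortzWedhorn2020, Definition 4.45 (2) (p. 117)] -/
theorem isFinite_ker_hom_of_isFinite [IsFinite ψ.left] : IsFinite (ker ψ).hom :=
  isFinite_ker_hom_of_isFinite_left ψ

/-- **KERNEL INCLUSION DECIDED ON `Ω`-POINTS** (`Ω = Ω̄`, `char Ω = 0`; `ψ : A → C` a homomorphism of abelian `Ω`-schemes with `ψ.left`
finite surjective, `φ : A → B` any morphism to an abelian `Ω`-scheme): if every `Ω`-point `P : Spec Ω → A` with `P ≫ ψ = 1` has `P ≫ φ = 1`, then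
`t ≫ ψ = 1 → t ≫ φ = 1` for EVERY `T`-valued point `t` of `A` (points on the `Motives.AlgPoints` test object `specOver Ω Ω`).
[cite: MumfordAV1970, §7 Thm. 4 (p. 72)] [cite: Tate1997FiniteFlatGroupSchemes, (3.7)] [cite: GortzWedhorn2020, Definition 4.45 (2) (p. 117)] -/
theorem comp_eq_one_of_forall_algPoints_of_charZero [IsAlgClosed Ω] [CharZero Ω] [IsFinite ψ.left] [Surjective ψ.left]
    (h : ∀ P : specOver Ω Ω ⟶ A.X, P ≫ ψ = 1 → P ≫ φ = 1)
    {T : Over (Spec (.of Ω))} (t : T ⟶ A.X) (ht : t ≫ ψ = 1) : t ≫ φ = 1 := by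
  haveI := etale_ker_hom_of_isFinite_of_surjective ψ
  haveI := isFinite_ker_hom_of_isFinite ψ
  exact comp_eq_one_of_comp_eq_one_of_forall_algPoint ψ φ h t ht

/-- **KERNEL EQUALITY DECIDED ON `Ω`-POINTS** (`Ω = Ω̄`, `char Ω = 0`; `ψ : A → C`, `φ : A → B` homomorphisms with finite surjective underlying
maps, i.e. isogenies): `P ≫ ψ = 1 ↔ P ≫ φ = 1` for `P : Spec Ω → A` ⇒ `t ≫ ψ = 1 ↔ t ≫ φ = 1` for every `T`-valued point — the `hker` of ★
`AbelianSchemeHomDescentKernelEq.exists_iso_comp_eq_of_comp_eq_one_iff` VERBATIM. [cite: MumfordAV1970, §7 Thm. 4 (p. 72)]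
[cite: Tate1997FiniteFlatGroupSchemes, (3.7)] [cite: GortzWedhorn2020, Definition 4.45 (2) (p. 117)] -/
theorem comp_eq_one_iff_of_forall_algPoints_of_charZero [IsAlgClosed Ω] [CharZero Ω] [IsFinite ψ.left] [Surjective ψ.left]
    [IsMonHom φ] [IsFinite φ.left] [Surjective φ.left]
    (h : ∀ P : specOver Ω Ω ⟶ A.X, P ≫ ψ = 1 ↔ P ≫ φ = 1)
    ⦃T : Over (Spec (.of Ω))⦄ (t : T ⟶ A.X) : t ≫ ψ = 1 ↔ t ≫ φ = 1 :=
  ⟨comp_eq_one_of_forall_algPoints_of_charZero ψ φ (fun P hP => (h P).1 hP) t,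
    comp_eq_one_of_forall_algPoints_of_charZero φ ψ (fun P hP => (h P).2 hP) t⟩

/-! The same in the `AbelianVariety.Points` ∕ `AlgPoints.map` spelling of the moduli datum (`RoofΩ` (r1)(r2): `(AlgPoints.map q P : B(Ω)) = 1` for
`P ∈ A(Ω) = A.toAffine.toAbelianVariety.Points Ω`; same carriers ★ `toAffine_X`, ★ `toAbelianVariety_X`, `AlgPoints.map q P = P ≫ q`). -/

/-- **KERNEL INCLUSION DECIDED ON `Ω`-POINTS, `A(Ω)` spelling**: if every `P ∈ A(Ω)` with `ψ(P) = 1` has `φ(P) = 1` (`AlgPoints.map`, values in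
`C(Ω)`, `B(Ω)`), then `t ≫ ψ = 1 → t ≫ φ = 1` for every `T`-valued point `t` of `A`. [cite: MumfordAV1970, §7 Thm. 4 (p. 72)]
[cite: Tate1997FiniteFlatGroupSchemes, (3.7)] [cite: GortzWedhorn2020, Definition 4.45 (2) (p. 117)] -/
theorem comp_eq_one_of_forall_points_of_charZero [IsAlgClosed Ω] [CharZero Ω] [IsFinite ψ.left] [Surjective ψ.left]
    (h : ∀ P : A.toAffine.toAbelianVariety.Points Ω,
      (AlgPoints.map ψ P : C.toAffine.toAbelianVariety.Points Ω) = 1 → (AlgPoints.map φ P : B.toAffine.toAbelianVariety.Points Ω) = 1)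
    {T : Over (Spec (.of Ω))} (t : T ⟶ A.X) (ht : t ≫ ψ = 1) : t ≫ φ = 1 :=
  comp_eq_one_of_forall_algPoints_of_charZero ψ φ (fun P hP => h P hP) t ht

/-- **KERNEL EQUALITY DECIDED ON `Ω`-POINTS, `A(Ω)` spelling** (both `ψ`, `φ` isogenies): `ψ(P) = 1 ↔ φ(P) = 1` on `A(Ω)` ⇒
`t ≫ ψ = 1 ↔ t ≫ φ = 1` for every `T`-valued point. [cite: MumfordAV1970, §7 Thm. 4 (p. 72)] [cite: Tate1997FiniteFlatGroupSchemes, (3.7)]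
[cite: GortzWedhorn2020, Definition 4.45 (2) (p. 117)] -/
theorem comp_eq_one_iff_of_forall_points_of_charZero [IsAlgClosed Ω] [CharZero Ω] [IsFinite ψ.left] [Surjective ψ.left]
    [IsMonHom φ] [IsFinite φ.left] [Surjective φ.left]
    (h : ∀ P : A.toAffine.toAbelianVariety.Points Ω,
      (AlgPoints.map ψ P : C.toAffine.toAbelianVariety.Points Ω) = 1 ↔ (AlgPoints.map φ P : B.toAffine.toAbelianVariety.Points Ω) = 1)
    ⦃T : Over (Spec (.of Ω))⦄ (t : T ⟶ A.X) : t ≫ ψ = 1 ↔ t ≫ φ = 1 :=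
  comp_eq_one_iff_of_forall_algPoints_of_charZero ψ φ (fun P => ⟨fun hP => (h P).1 hP, fun hP => (h P).2 hP⟩) t

/-! The FIBRE forms: `A = 𝒜 ×_S Spec Ω` for `t₀ : Spec Ω → S`, points of `(𝒜.fibre t₀).toAbelianVariety` (★ `fibre = (baseChange).toAffine`) — the
`schΩOf` ∕ `fibreΩOf` pair of the moduli datum. -/

section Fibre

variable {S : Scheme.{u}} (𝒜 : AbelianSchemeOver S) (t₀ : Spec (.of Ω) ⟶ S)
  (ψ' : (𝒜.baseChange t₀).X ⟶ C.X) [IsMonHom ψ'] (φ' : (𝒜.baseChange t₀).X ⟶ B.X)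

/-- `comp_eq_one_of_forall_points_of_charZero` on a geometric fibre `𝒜_{t₀}`, points of `(𝒜.fibre t₀).toAbelianVariety`.
[cite: MumfordAV1970, §7 Thm. 4 (p. 72)] [cite: GortzWedhorn2020, Definition 4.45 (2) (p. 117)] -/
theorem comp_eq_one_of_forall_points_of_charZero_fibre [IsAlgClosed Ω] [CharZero Ω] [IsFinite ψ'.left] [Surjective ψ'.left]
    (h : ∀ P : (𝒜.fibre t₀).toAbelianVariety.Points Ω,
      (AlgPoints.map ψ' P : C.toAffine.toAbelianVariety.Points Ω) = 1 → (AlgPoints.map φ' P : B.toAffine.toAbelianVariety.Points Ω) = 1)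
    {T : Over (Spec (.of Ω))} (t : T ⟶ (𝒜.baseChange t₀).X) (ht : t ≫ ψ' = 1) : t ≫ φ' = 1 :=
  comp_eq_one_of_forall_points_of_charZero ψ' φ' h t ht

/-- `comp_eq_one_iff_of_forall_points_of_charZero` on a geometric fibre `𝒜_{t₀}`. [cite: MumfordAV1970, §7 Thm. 4 (p. 72)]
[cite: GortzWedhorn2020, Definition 4.45 (2) (p. 117)] -/
theorem comp_eq_one_iff_of_forall_points_of_charZero_fibre [IsAlgClosed Ω] [CharZero Ω] [IsFinite ψ'.left] [Surjective ψ'.left]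
    [IsMonHom φ'] [IsFinite φ'.left] [Surjective φ'.left]
    (h : ∀ P : (𝒜.fibre t₀).toAbelianVariety.Points Ω,
      (AlgPoints.map ψ' P : C.toAffine.toAbelianVariety.Points Ω) = 1 ↔ (AlgPoints.map φ' P : B.toAffine.toAbelianVariety.Points Ω) = 1)
    ⦃T : Over (Spec (.of Ω))⦄ (t : T ⟶ (𝒜.baseChange t₀).X) : t ≫ ψ' = 1 ↔ t ≫ φ' = 1 :=
  comp_eq_one_iff_of_forall_points_of_charZero ψ' φ' h t

end Fibre

/-! ### §4 Family form: `Ker c = ⋂ᵢ Ker φᵢ` -/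

/-- **FAMILY FORM** (`Ω = Ω̄`, `char Ω = 0`): `c : A → C` an isogeny, `φᵢ : A → Bᵢ` (`i` with `p i`) homomorphisms, and ONE auxiliary isogeny
`ψ′ : A → C′` whose scheme-theoretic kernel is `⋂ᵢ Ker φᵢ` (`t ≫ ψ′ = 1 ↔ ∀ i, p i → t ≫ φᵢ = 1`, e.g. the Serre translate `A → A ⊗ 𝔞⁻¹` for
the `𝔞`-torsion `⋂_{a ∈ 𝔞} Ker ι(a)`).  If `c(P) = 1 ↔ ∀ i, p i → φᵢ(P) = 1` on `A(Ω)` (the shape of `RoofΩ` (r2)), then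
`t ≫ c = 1 ↔ ∀ i, p i → t ≫ φᵢ = 1` for every `T`-valued point `t`. [cite: MumfordAV1970, §7 Thm. 4 (p. 72)]
[cite: Tate1997FiniteFlatGroupSchemes, (3.7)] [cite: GortzWedhorn2020, Definition 4.45 (2) (p. 117)] -/
theorem comp_eq_one_iff_forall_of_forall_points_of_charZero [IsAlgClosed Ω] [CharZero Ω] {C' : AbelianSchemeOver (Spec (.of Ω))}
    (c : A.X ⟶ C.X) [IsMonHom c] [IsFinite c.left] [Surjective c.left]
    (ψ₀ : A.X ⟶ C'.X) [IsMonHom ψ₀] [IsFinite ψ₀.left] [Surjective ψ₀.left]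
    {J : Type*} (p : J → Prop) (Bi : J → AbelianSchemeOver (Spec (.of Ω))) (φi : ∀ i, A.X ⟶ (Bi i).X)
    (hψ₀ : ∀ ⦃T : Over (Spec (.of Ω))⦄ (t : T ⟶ A.X), t ≫ ψ₀ = 1 ↔ ∀ i, p i → t ≫ φi i = 1)
    (h : ∀ P : A.toAffine.toAbelianVariety.Points Ω,
      (AlgPoints.map c P : C.toAffine.toAbelianVariety.Points Ω) = 1 ↔
        ∀ i, p i → (AlgPoints.map (φi i) P : (Bi i).toAffine.toAbelianVariety.Points Ω) = 1)
    ⦃T : Over (Spec (.of Ω))⦄ (t : T ⟶ A.X) : t ≫ c = 1 ↔ ∀ i, p i → t ≫ φi i = 1 := by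
  rw [← hψ₀ t]
  exact comp_eq_one_iff_of_forall_points_of_charZero c ψ₀ (fun P => (h P).trans (hψ₀ P).symm) t

end AbelianSchemeOver

end Literature.AlgebraicGeometry.AbelianSchemes

end
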